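import Summits.BirchSwinnertonDyer.BirchSwinnertonDyer.Theorems.AdditiveKolyvaginRoadLowerHalfDescentQuadratic
import Summits.BirchSwinnertonDyer.Rank1Residual.Additive.X4RankZeroUpperBoundThree
import Literature.NumberTheory.EllipticCurves.NonEisensteinPrimeOfSurjective
import HarnessLib

/-!
# Route `AdditiveKolyvaginRoad`: the partner's UPPER half at an additive `p ≥ 5` from Kim–Nakamura, and the assembled over-`ℚ`
# re-entry «LOWER over an auxiliary quadratic field + Kim–Nakamura for the partner twist ⟹ `Typed.MissingLowerBoundAt` over `ℚ`»
# (crux KS′ `LevelKolyvaginSystemsAdditive`, item stmt-BirchSwinnertonDyer-21396; card `parahoric-ordinary-type-engine`, over-`ℚ` socket;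
# cell `pub/bsd-wall`, width seat `bsd-wall-akr-p2x-w4` g4; `--supports` 21396, helper)

THEOREMS ONLY (no definition, no named fact, no `sorry`).  CONDITIONAL on the displayed named facts — Kim–Nakamura 2020 Thm. 1.7
(`KimNakamura2020.rankZero_padicValNat_sha_le_of_maninConstant`), Gross–Zagier–Kolyvagin (`rank_eq_analyticRank_of_analyticRank_le_one`),
modularity (`hasEntireLFunction_rat`), Dokchitser–Dokchitser 2010 Thm. 2.3 (`Milne1972.bsdQuotientP_baseChange_relQuadratic_anyModel`) — and
on the displayed LOWER half over the auxiliary field (the engine's output, research).  BSD is not proved by any of this; KS′ and KPA′ stay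
OPEN at `p² ∣ N`.

* §1 `missingUpperBoundAt_of_kimNakamura` — for `W/ℚ` globally minimal, `p` odd ADDITIVE with `p > 7` or `(E,p)` non-exceptional,
  `r_an = 0`, `ρ̄_{E,p^n}` onto for all `n`, `p ∤ ∏ c_ℓ · ∏_{ℓ ∥ N}(ℓ ∓ 1)`, a parametrisation with `p ∤ c_D`: `Typed.MissingUpperBoundAt W p`
  (`ord_p #Ш(E) ≤ ord_p #Ш(E)_an`).  The tree's `X4RankZero.missingUpperBoundAt_three_of_kimNakamura` is the case `p = 3`; this is the
  same two-line reading of `padicValNat_shaOrder_le_of_kimNakamura_rankZero` (`p ∤ #E(ℚ)_tors` by irreducibility, `p ∤ ∏ c_ℓ`) at any odd `p`.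
* §2 `missingLowerBoundAt_of_lowerBaseChange_of_kimNakamura_twist` — the ASSEMBLED re-entry for a curve `W/ℚ` of analytic rank `≤ 1`:
  an auxiliary quadratic field `K = ℚ(θ₁)`, `θ₁² = c`, a globally minimal model `Wc` of `W^{(c)}` which is additive at `p` of analytic
  rank `0` with the Kim–Nakamura binders, any `K`-model `VK` of `W_K`, and the LOWER half of `BSD_p` for `VK` («`#Ш_an(VK) = qK ∈ ℚ`,
  `ord_p qK ≤ ord_p #Ш(VK)[p^∞]`», e.g. `EngineRankZeroPairDeliverable` of the parahoric card) ⟹ `Typed.MissingLowerBoundAt W p` — the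
  hypothesis `hlow` ∕ `hlowTw` of width seat akr-p2x-w5's landing socket `AdditiveKoly.exists_kolyvaginClass_ne_zero_of_lowerHalves`.

References: C.-H. Kim, K. Nakamura, J. Number Theory 210 (2020) Thm. 1.7, Rem. 1.8; R. L. Miller, LMS JCM 14 (2011) Def. 1.1;
T. Dokchitser, V. Dokchitser, Ann. of Math. 172 (2010) Thm. 2.3.
-/

-- D-0017: single-problem summit, so `Summit.BirchSwinnertonDyer.BirchSwinnertonDyer.…` repeats a namespace BY DESIGN.
set_option linter.dupNamespace false
set_option autoImplicit false

noncomputable section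

open scoped NumberField Classical

open NumberField WeierstrassCurve
  Literature.NumberTheory.EllipticCurves Literature.NumberTheory.EllipticCurves.ModularForms
  Literature.NumberTheory.EllipticCurves.Rank1Residual Literature.NumberTheory.EllipticCurves.Rank1Residual.Typed
  Summit.BirchSwinnertonDyer.Rank1Residual Summit.BirchSwinnertonDyer.Rank1Residual.Additive

namespace Summit.BirchSwinnertonDyer.BirchSwinnertonDyer.Theorems.AdditiveKoly.QuadraticDescent

/-! ## §1 The UPPER half at an additive odd `p` in analytic rank `0` (Kim–Nakamura) -/

/-- **`Typed.MissingUpperBoundAt W p` in analytic rank `0` at an ADDITIVE odd `p` from Kim–Nakamura 2020 Thm. 1.7 (named fact `hKN`),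
Gross–Zagier–Kolyvagin (`hGZK`: `Ш(E)` finite) and modularity (`hmod`).**  Binders: `p ≠ 2` additive (`Addv W p`), `p > 7` or `(E,p)` not
exceptional, `r_an(E) = 0`, `ρ̄_{E,p^n}` onto for every `n`, `p ∤ ∏ c_ℓ`, `p ∤ ℓ − 1` (split) ∕ `p ∤ ℓ + 1` (non-split) at the multiplicative `ℓ`,
a parametrisation datum `D` with `p ∤ c_D`.  Proof: `padicValNat_shaOrder_le_of_kimNakamura_rankZero` gives
`ord_p #Ш ≤ ord_p #Ш_an + ord_p ∏ c_ℓ − 2 ord_p #tors`, and `p ∤ ∏ c_ℓ`, `p ∤ #E(ℚ)_tors` (`ρ̄` irreducible).  The tree's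
`X4RankZero.missingUpperBoundAt_three_of_kimNakamura` is the case `p = 3`.
[cite: KimNakamura2020, Thm. 1.7 and Rem. 1.8 (1) (arXiv p. 4); Thm. 4.2 (2), Cor. 2.4] [cite: Miller2011LMS, Def. 1.1 (arXiv:1010.2431 p. 3)] -/
theorem missingUpperBoundAt_of_kimNakamura (W : WeierstrassCurve ℚ) [W.IsElliptic] [W.IsGloballyMinimal] (p : ℕ) [hp : Fact p.Prime]
    (hKN : KimNakamura2020.rankZero_padicValNat_sha_le_of_maninConstant)
    (hGZK : rank_eq_analyticRank_of_analyticRank_le_one) (hmod : hasEntireLFunction_rat)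
    (hp2 : p ≠ 2) (hadd : Addv W p) (hexc : 7 < p ∨ KimNakamura2020.NonExceptional W p) (hr : W.analyticRank = 0)
    (hsurj : ∀ n : ℕ, W.HasSurjectiveModNGaloisRep (p ^ n : ℕ)) (htam : ¬ p ∣ W.tamagawaProduct)
    (hmult : ∀ (ℓ : ℕ) [Fact ℓ.Prime], W.HasMultiplicativeReductionAtPrime ℓ →
      (W.HasSplitMultiplicativeReductionAtPrime ℓ → ¬ p ∣ ℓ - 1) ∧
        (¬ W.HasSplitMultiplicativeReductionAtPrime ℓ → ¬ p ∣ ℓ + 1))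
    {N : ℕ} [NeZero N] (D : ModularParametrizationData W N) (hc : ¬ (p : ℤ) ∣ D.maninConstant) :
    MissingUpperBoundAt W p := by
  have hs : W.HasSurjectiveModNGaloisRep p := by simpa using hsurj 1
  have hirr : W.HasIrreducibleModPGaloisRep p := hasIrreducibleModPGaloisRep_of_hasSurjectiveModNGaloisRep W p hs
  obtain ⟨q', hq', hle⟩ := padicValNat_shaOrder_le_of_kimNakamura_rankZero W p hKN hGZK hmod hp2 hadd hexc hr hsurj htam
    hmult D hc
  refine ⟨q', hq', ?_⟩
  rw [padicValNat_torsionOrder_eq_zero_of_irreducible W p hirr, padicValNat.eq_zero_of_not_dvd htam] at hle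
  simpa using hle

/-! ## §2 The assembled re-entry: LOWER over an auxiliary quadratic field + Kim–Nakamura for the partner ⟹ LOWER over `ℚ` -/

/-- **The Eisenstein half of `BSD(E,p)` over `ℚ` from an AUXILIARY quadratic field and Kim–Nakamura for the partner twist.**  For `W/ℚ`
globally minimal of analytic rank `≤ 1` (so `Ш(E)` finite by `hGZK`), a quadratic field `K = ℚ(θ₁)` (`θ₁² = c`), a globally minimal model
`Wc` of `W^{(c)}` which is ADDITIVE at the odd prime `p`, of analytic rank `0`, with the Kim–Nakamura binders of §1 (image, `(ℓ ∓ 1)`,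
Tamagawa, non-exceptionality, a parametrisation with `p ∤ c_D`), any `K`-model `VK` of `W_K`, and the LOWER half of `BSD_p` for `VK`
(«`#Ш_an(VK) = qK ∈ ℚ` with `ord_p qK ≤ ord_p #Ш(VK)[p^∞]`» — the OUTPUT CURRENCY of an Eisenstein-congruence engine run over the
auxiliary field, e.g. the parahoric card's `EngineRankZeroPairDeliverable`): `Typed.MissingLowerBoundAt W p`.  GIVEN `hDD`, `hKN`, `hGZK`,
`hmod` (named facts, displayed).  This is `missingLowerBoundAt_of_lowerBaseChange_of_missingUpperBoundAt_twist` with its `hcUp` discharged by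
§1; it feeds `hlow` (for `W = E`) and `hlowTw` (for `W` = a minimal model of `E^{(d_K)}`) of
`AdditiveKoly.exists_kolyvaginClass_ne_zero_of_lowerHalves`. [cite: KimNakamura2020, Thm. 1.7 and Rem. 1.8 (1) (arXiv p. 4)]
[cite: DokchitserDokchitserAnnals2010, §2.1 Thm. 2.3] [cite: Miller2011LMS, Def. 1.1 (arXiv:1010.2431 p. 3)] -/
theorem missingLowerBoundAt_of_lowerBaseChange_of_kimNakamura_twist
    (hDD : Milne1972.bsdQuotientP_baseChange_relQuadratic_anyModel)
    (hKN : KimNakamura2020.rankZero_padicValNat_sha_le_of_maninConstant)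
    (hGZK : rank_eq_analyticRank_of_analyticRank_le_one) (hmod : hasEntireLFunction_rat)
    (W : WeierstrassCurve ℚ) [W.IsElliptic] [W.IsGloballyMinimal] (hrW : W.analyticRank ≤ 1)
    (K : Type) [Field K] [NumberField K] (h2 : Module.finrank ℚ K = 2)
    {c : ℚ} {θ₁ : K} (hθ₁ : θ₁ ^ 2 = algebraMap ℚ K c) (hθK : θ₁ ∉ Set.range (algebraMap ℚ K))
    (Wc : WeierstrassCurve ℚ) [Wc.IsElliptic] [Wc.IsGloballyMinimal]
    (hWc : ∃ C : WeierstrassCurve.VariableChange ℚ, C • W.quadraticTwist c = Wc)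
    (VK : WeierstrassCurve K) [VK.IsElliptic]
    (hVK : ∃ C : WeierstrassCurve.VariableChange K, C • W.baseChange K = VK)
    (p : ℕ) [hp : Fact p.Prime] (hp2 : p ≠ 2)
    -- the partner twist: additive at `p`, analytic rank `0`, Kim–Nakamura binders
    (haddc : Addv Wc p) (hexc : 7 < p ∨ KimNakamura2020.NonExceptional Wc p) (hrc : Wc.analyticRank = 0)
    (hsurjc : ∀ n : ℕ, Wc.HasSurjectiveModNGaloisRep (p ^ n : ℕ)) (htamc : ¬ p ∣ Wc.tamagawaProduct)
    (hmultc : ∀ (ℓ : ℕ) [Fact ℓ.Prime], Wc.HasMultiplicativeReductionAtPrime ℓ →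
      (Wc.HasSplitMultiplicativeReductionAtPrime ℓ → ¬ p ∣ ℓ - 1) ∧
        (¬ Wc.HasSplitMultiplicativeReductionAtPrime ℓ → ¬ p ∣ ℓ + 1))
    {Nc : ℕ} [NeZero Nc] (Dc : ModularParametrizationData Wc Nc) (hcc : ¬ (p : ℤ) ∣ Dc.maninConstant)
    -- the LOWER half over the auxiliary field (engine output)
    (hKlow : ∃ qK : ℚ, analyticSha VK = (qK : ℂ) ∧
      padicValRat p qK ≤ padicValNat p (Nat.card (AddCommGroup.primaryComponent VK.sha p))) :
    MissingLowerBoundAt W p := by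
  have hWfin : W.ShaFinite := (hGZK W hrW).2
  have hWcfin : Wc.ShaFinite := (hGZK Wc (by rw [hrc]; exact zero_le_one)).2
  have hcUp : MissingUpperBoundAt Wc p :=
    missingUpperBoundAt_of_kimNakamura Wc p hKN hGZK hmod hp2 haddc hexc hrc hsurjc htamc hmultc Dc hcc
  exact missingLowerBoundAt_of_lowerBaseChange_of_missingUpperBoundAt_twist hDD W K h2 hθ₁ hθK Wc hWc VK hVK p hWfin hWcfin
    (hmod W) (hmod Wc) hKlow hcUp

end Summit.BirchSwinnertonDyer.BirchSwinnertonDyer.Theorems.AdditiveKoly.QuadraticDescent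

end
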